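import Literature.NumberTheory.LFunctions.MauduitRivatFourier
import Literature.NumberTheory.Sieve.VinogradovExpSumTools
import Literature.Analysis.Fourier.FejerJacksonKernels
import HarnessLib

/-!
# A discrete Fejér smoothing of digit-block indicators (substitute for Mauduit–Rivat 2015, Lemmas 1–2; proved)

Everything in this file is PROVED. In the type-II estimate of C. Mauduit, J. Rivat, *Prime numbers
along Rudin–Shapiro sequences*, J. Eur. Math. Soc. 17 (2015), §6, the middle digits
`r_{μ₀,μ₂}(x) = u₀` are detected ((11)) by the indicator `χ_α` of an interval modulo 1, which is
then replaced (Lemmas 1–2, Vaaler's trigonometric approximation `|χ_α − A_{α,H}| ≤ B_{α,H}` with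
`A, B` of degree `H`) by trigonometric polynomials ((64)). Since all points involved are `K`-th
roots of unity (`K = k^{μ₂}`), we use instead a purely DISCRETE smoothing on `ℤ/K`, which needs no
extremal functions: the normalised discrete Fejér kernel

  `Φ(a) = |∑_{1≤j≤H} e(ja/K)|² / (HK)`  (`fejerPhi K H a`; this is the classical Fejér kernel of
  the tree, `TrigApprox.fejer (H−1) (a/K) / K` — `fejerPhi_eq_fejer_div`),

and (in the sequel) the smoothed block indicators `A_{u₀}(x) = ∑_{y ∈ [u₀L, u₀L+L)} Φ(x − y)`.
Here we prove the kernel facts: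

* `fejerPhi_nonneg`, `fejerPhi_add_mul`, `fejerPhi_mod` — `Φ ≥ 0` is `K`-periodic;
* `sum_range_fejerPhi` — `∑_{a<K} Φ(a) = 1` (`1 ≤ H ≤ K`; orthogonality of characters);
* `fejerPhi_mul_distInt_sq_le` — `Φ(a) ‖a/K‖² ≤ 1/(4HK)` (geometric sums, Nathanson Lemma 4.7);
* `sum_fejerPhi_tail_le` — the tail estimate `∑_{a<K, T ≤ min(a,K−a)} Φ(a) ≤ K/(HT)`;
* `fejerPhi_eq_sum` — `Φ(a) = (HK)⁻¹ ∑_{j,j'} e((j−j')a/K)` in `ℂ` (all frequencies `|j−j'| < H`),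
  the source of the exact Fourier expansion of the smoothed indicators.

## References
* C. Mauduit, J. Rivat, J. Eur. Math. Soc. 17 (2015), §3 (11)–(18) and §6 (64).
  [MauduitRivat2015]
* M. B. Nathanson, *Additive Number Theory: the Classical Bases*, Lemma 4.7 (geometric sums;
  tree `Sieve.Vinogradov`). [Nathanson1996]
-/

noncomputable section

open Finset Complex
open scoped FourierTransform ComplexConjugate

namespace Literature.NumberTheory.LFunctions.MauduitRivat

open Literature.NumberTheory.Sieve.Vinogradov (distInt distInt_nonneg
  norm_sum_Ioc_fourierChar_mul_distInt_le)
open Literature.NumberTheory.Sieve.RamanujanSum (sum_range_fourierChar_div fourierChar_intCast)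

/-! ## Exponential-sum helpers -/

/-- `conj e(x) = e(−x)`. [folklore] -/
theorem conj_coe_fourierChar (x : ℝ) : conj (𝐞 x : ℂ) = (𝐞 (-x) : ℂ) := by
  rw [← Circle.coe_inv_eq_conj, ← AddChar.map_neg_eq_inv]

/-- `‖∑_{j∈s} e(j t)‖²` as a double sum: `= ∑_{j,j'∈s} e((j − j') t)`. [folklore] -/
theorem norm_sq_sum_fourierChar_eq (s : Finset ℕ) (t : ℝ) :
    ((‖∑ j ∈ s, (𝐞 ((j : ℝ) * t) : ℂ)‖ : ℂ) ^ 2) =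
      ∑ j ∈ s, ∑ j' ∈ s, (𝐞 (((j : ℝ) - j') * t) : ℂ) := by
  rw [← Complex.mul_conj', map_sum, sum_mul_sum]
  refine sum_congr rfl fun j _ => sum_congr rfl fun j' _ => ?_
  rw [conj_coe_fourierChar, coe_fourierChar_mul]
  congr 2
  ring

/-- `min(x, 1 − x) ≤ |x − n|` for `0 ≤ x ≤ 1` and every integer `n`. [folklore] -/
theorem min_le_abs_sub_int {x : ℝ} (h0 : 0 ≤ x) (h1 : x ≤ 1) (n : ℤ) :
    min x (1 - x) ≤ |x - n| := by
  rcases le_or_gt n 0 with hn | hn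
  · have : (n : ℝ) ≤ 0 := by exact_mod_cast hn
    calc min x (1 - x) ≤ x := min_le_left _ _
      _ ≤ |x - n| := by rw [abs_of_nonneg (by linarith)]; linarith
  · have : (1 : ℝ) ≤ n := by exact_mod_cast hn
    calc min x (1 - x) ≤ 1 - x := min_le_right _ _
      _ ≤ |x - n| := by rw [abs_of_nonpos (by linarith)]; linarith

/-- `min(a, K − a)/K ≤ ‖a/K‖` for `a ≤ K`, `K ≥ 1` (real `min`). [folklore] -/
theorem min_div_le_distInt {a K : ℕ} (hK : 0 < K) (ha : a ≤ K) :
    min (a : ℝ) ((K : ℝ) - a) / K ≤ distInt ((a : ℝ) / K) := by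
  have hKR : (0 : ℝ) < K := by exact_mod_cast hK
  have hx0 : (0 : ℝ) ≤ (a : ℝ) / K := by positivity
  have hx1 : (a : ℝ) / K ≤ 1 := by rw [div_le_one hKR]; exact_mod_cast ha
  have h := min_le_abs_sub_int hx0 hx1 (round ((a : ℝ) / K))
  unfold distInt
  refine le_trans (le_of_eq ?_) h
  rw [show (1 : ℝ) - (a : ℝ) / K = ((K : ℝ) - a) / K by field_simp, min_div_div_right hKR.le]

/-! ## The discrete Fejér kernel -/

/-- The normalised discrete Fejér kernel on `ℤ/K`: `Φ(a) = |∑_{1≤j≤H} e(ja/K)|²/(HK)` — the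
classical Fejér kernel (tree: `Literature.Analysis.Fourier.TrigApprox.fejer`, cf. Travaglini §7.1)
sampled at `a/K` and renormalised: `fejerPhi K H a = TrigApprox.fejer (H−1) (a/K) / K` for `H ≥ 1`
(`fejerPhi_eq_fejer_div`). [folklore] -/
def fejerPhi (K H : ℕ) (a : ℕ) : ℝ :=
  ‖∑ j ∈ Ioc 0 H, (𝐞 ((j : ℝ) * ((a : ℝ) / K)) : ℂ)‖ ^ 2 / ((H : ℝ) * K)

/-- Unfolding. [folklore] -/
theorem fejerPhi_apply (K H a : ℕ) :
    fejerPhi K H a = ‖∑ j ∈ Ioc 0 H, (𝐞 ((j : ℝ) * ((a : ℝ) / K)) : ℂ)‖ ^ 2 / ((H : ℝ) * K) := rfl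

/-- `Φ ≥ 0`. [folklore] -/
theorem fejerPhi_nonneg (K H a : ℕ) : 0 ≤ fejerPhi K H a := by
  rw [fejerPhi_apply]; positivity

/-- `TrigApprox.e t = 𝐞 t` (both are `exp(2πit)`). [folklore] -/
theorem trigApprox_e_eq (t : ℝ) : Literature.Analysis.Fourier.TrigApprox.e t = (𝐞 t : ℂ) := by
  rw [Literature.Analysis.Fourier.TrigApprox.e, Real.fourierChar_apply]
  push_cast
  ring_nf

/-- **Bridge to the tree's Fejér kernel**: for `H ≥ 1`,
`fejerPhi K H a = TrigApprox.fejer (H − 1) (a/K) / K`. [folklore] -/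
theorem fejerPhi_eq_fejer_div {H : ℕ} (hH : 0 < H) (K a : ℕ) :
    fejerPhi K H a = Literature.Analysis.Fourier.TrigApprox.fejer (H - 1) ((a : ℝ) / K) / K := by
  rw [fejerPhi_apply, Literature.Analysis.Fourier.TrigApprox.fejer,
    Literature.Analysis.Fourier.TrigApprox.dirSum, Nat.sub_add_cancel hH]
  -- `∑_{1≤j≤H} e(jy) = e(y) ∑_{0≤j<H} e(jy)`
  have e : ∑ j ∈ Ioc 0 H, (𝐞 ((j : ℝ) * ((a : ℝ) / K)) : ℂ) =
      (𝐞 ((a : ℝ) / K) : ℂ) * ∑ j ∈ range H, Literature.Analysis.Fourier.TrigApprox.e (j * ((a : ℝ) / K)) := by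
    rw [mul_sum]
    refine (sum_nbij' (fun j => j - 1) (fun j => j + 1) ?_ ?_ ?_ ?_ ?_)
    · intro j hj; rw [mem_Ioc] at hj; rw [mem_range]; omega
    · intro j hj; rw [mem_range] at hj; rw [mem_Ioc]; omega
    · intro j hj; rw [mem_Ioc] at hj; omega
    · intro j _; simp
    · intro j hj
      rw [mem_Ioc] at hj
      rw [trigApprox_e_eq, coe_fourierChar_mul]
      congr 2
      rw [Nat.cast_sub hj.1]
      push_cast
      ring
  rw [e, norm_mul, norm_fourierChar, one_mul]
  have hH' : ((H - 1 : ℕ) : ℝ) + 1 = H := by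
    rw [Nat.cast_sub hH]; push_cast; ring
  rw [hH', div_div]

/-- The character sum is `K`-periodic in `a`. [folklore] -/
theorem sum_fourierChar_add_mul (K H a t : ℕ) (hK : 0 < K) :
    ∑ j ∈ Ioc 0 H, (𝐞 ((j : ℝ) * (((a + t * K : ℕ) : ℝ) / K)) : ℂ) =
      ∑ j ∈ Ioc 0 H, (𝐞 ((j : ℝ) * ((a : ℝ) / K)) : ℂ) := by
  have hKR : (K : ℝ) ≠ 0 := by exact_mod_cast hK.ne'
  refine sum_congr rfl fun j _ => ?_
  have e : (j : ℝ) * (((a + t * K : ℕ) : ℝ) / K) = (j : ℝ) * ((a : ℝ) / K) + (((j * t : ℕ) : ℤ) : ℝ) := by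
    push_cast; field_simp
  rw [e, ← coe_fourierChar_mul, fourierChar_intCast, mul_one]

/-- `Φ` is `K`-periodic. [folklore] -/
theorem fejerPhi_add_mul (K H a t : ℕ) : fejerPhi K H (a + t * K) = fejerPhi K H a := by
  rcases Nat.eq_zero_or_pos K with hK | hK
  · subst hK; simp only [mul_zero, add_zero]
  rw [fejerPhi_apply, fejerPhi_apply, sum_fourierChar_add_mul K H a t hK]

/-- `Φ(n mod K) = Φ(n)`. [folklore] -/
theorem fejerPhi_mod (K H n : ℕ) : fejerPhi K H (n % K) = fejerPhi K H n := by
  conv_rhs => rw [← Nat.mod_add_div n K, mul_comm]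
  exact (fejerPhi_add_mul K H (n % K) (n / K)).symm

/-- The kernel as a double character sum (in `ℂ`):
`Φ(a) = (HK)⁻¹ ∑_{1≤j,j'≤H} e((j − j') a / K)`. [folklore] -/
theorem fejerPhi_eq_sum (K H a : ℕ) :
    ((fejerPhi K H a : ℝ) : ℂ) =
      (((H : ℂ) * K)⁻¹) * ∑ j ∈ Ioc 0 H, ∑ j' ∈ Ioc 0 H, (𝐞 (((j : ℝ) - j') * ((a : ℝ) / K)) : ℂ) := by
  rw [fejerPhi_apply]
  push_cast
  rw [norm_sq_sum_fourierChar_eq, div_eq_inv_mul]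

/-- Orthogonality for the frequencies `j − j'`, `1 ≤ j, j' ≤ H ≤ K`:
`∑_{a<K} e((j−j')a/K) = K [j = j']`. [folklore] -/
theorem sum_range_fourierChar_sub {K H : ℕ} (hHK : H ≤ K) {j j' : ℕ} (hj : j ∈ Ioc 0 H)
    (hj' : j' ∈ Ioc 0 H) :
    ∑ a ∈ range K, (𝐞 (((j : ℝ) - j') * ((a : ℝ) / K)) : ℂ) = if j = j' then (K : ℂ) else 0 := by
  rw [mem_Ioc] at hj hj'
  have hK : 0 < K := by omega
  have h := sum_range_fourierChar_div hK.ne' ((j : ℤ) - j')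
  have e : ∑ a ∈ range K, (𝐞 (((j : ℝ) - j') * ((a : ℝ) / K)) : ℂ) =
      ∑ a ∈ range K, (𝐞 ((a : ℝ) * (((j : ℤ) - j' : ℤ) : ℝ) / K) : ℂ) := by
    refine sum_congr rfl fun a _ => ?_
    congr 2; push_cast; ring
  rw [e, h]
  by_cases hjj : j = j'
  · subst hjj; simp
  · rw [if_neg, if_neg hjj]
    intro hd
    have hne : (j : ℤ) - j' ≠ 0 := by omega
    rcases lt_or_gt_of_ne hne with hlt | hgt
    · have h1 : (K : ℤ) ∣ -((j : ℤ) - j') := (dvd_neg).2 hd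
      have h2 := Int.le_of_dvd (by omega) h1
      omega
    · have h2 := Int.le_of_dvd hgt hd
      omega

/-- **Normalisation**: `∑_{a<K} Φ(a) = 1` for `1 ≤ H ≤ K`. [folklore] -/
theorem sum_range_fejerPhi {K H : ℕ} (hH : 0 < H) (hHK : H ≤ K) :
    ∑ a ∈ range K, fejerPhi K H a = 1 := by
  have hK : 0 < K := hH.trans_le hHK
  have hKC : (K : ℂ) ≠ 0 := by exact_mod_cast hK.ne'
  have hHC : (H : ℂ) ≠ 0 := by exact_mod_cast hH.ne'
  have key : ((∑ a ∈ range K, fejerPhi K H a : ℝ) : ℂ) = 1 := by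
    push_cast
    simp only [fejerPhi_eq_sum]
    rw [← mul_sum]
    -- swap: `∑_a ∑_j ∑_j' = ∑_j ∑_j' ∑_a`
    have hswap : ∑ a ∈ range K, ∑ j ∈ Ioc 0 H, ∑ j' ∈ Ioc 0 H,
        (𝐞 (((j : ℝ) - j') * ((a : ℝ) / K)) : ℂ) =
        ∑ j ∈ Ioc 0 H, ∑ j' ∈ Ioc 0 H, ∑ a ∈ range K, (𝐞 (((j : ℝ) - j') * ((a : ℝ) / K)) : ℂ) := by
      rw [sum_comm]
      exact sum_congr rfl fun j _ => sum_comm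
    rw [hswap]
    have hinner : ∀ j ∈ Ioc 0 H, ∑ j' ∈ Ioc 0 H, ∑ a ∈ range K,
        (𝐞 (((j : ℝ) - j') * ((a : ℝ) / K)) : ℂ) = K := by
      intro j hj
      rw [sum_congr rfl fun j' hj' => sum_range_fourierChar_sub hHK hj hj', sum_ite_eq]
      rw [if_pos hj]
    rw [sum_congr rfl hinner, sum_const, Nat.card_Ioc, Nat.sub_zero, nsmul_eq_mul]
    field_simp
  exact_mod_cast key

/-- **Pointwise decay**: `Φ(a) · ‖a/K‖² ≤ 1/(4HK)` (from `|∑_{j≤H} e(jt)| ‖t‖ ≤ 1/2`). [folklore] -/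
theorem fejerPhi_mul_distInt_sq_le {K H : ℕ} (hH : 0 < H) (hK : 0 < K) (a : ℕ) :
    fejerPhi K H a * distInt ((a : ℝ) / K) ^ 2 ≤ 1 / (4 * H * K) := by
  have hHR : (0 : ℝ) < H := by exact_mod_cast hH
  have hKR : (0 : ℝ) < K := by exact_mod_cast hK
  have h := norm_sum_Ioc_fourierChar_mul_distInt_le 0 H ((a : ℝ) / K)
  have h0 : 0 ≤ ‖∑ n ∈ Ioc 0 H, (𝐞 ((n : ℝ) * ((a : ℝ) / K)) : ℂ)‖ * distInt ((a : ℝ) / K) :=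
    mul_nonneg (norm_nonneg _) (distInt_nonneg _)
  have h2 : (‖∑ n ∈ Ioc 0 H, (𝐞 ((n : ℝ) * ((a : ℝ) / K)) : ℂ)‖ * distInt ((a : ℝ) / K)) ^ 2 ≤
      (1 / 2) ^ 2 := pow_le_pow_left₀ h0 h 2
  rw [fejerPhi_apply, div_mul_eq_mul_div, ← mul_pow]
  calc (‖∑ n ∈ Ioc 0 H, (𝐞 ((n : ℝ) * ((a : ℝ) / K)) : ℂ)‖ * distInt ((a : ℝ) / K)) ^ 2 / ((H : ℝ) * K)
      ≤ (1 / 2 : ℝ) ^ 2 / ((H : ℝ) * K) := by gcongr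
    _ = (1 : ℝ) / (4 * H * K) := by field_simp; norm_num

/-- `∑_{T ≤ t < X} 1/t² ≤ 2/T` for `T ≥ 1`. [folklore] -/
theorem sum_Ico_inv_sq_le {T X : ℕ} (hT : 1 ≤ T) :
    ∑ t ∈ Ico T X, ((t : ℝ) ^ 2)⁻¹ ≤ 2 / T := by
  have hTR : (1 : ℝ) ≤ T := by exact_mod_cast hT
  have hstep : ∀ t : ℕ, 1 ≤ t →
      ((t : ℝ) ^ 2)⁻¹ ≤ 1 / ((t : ℝ) - 1 / 2) - 1 / ((t : ℝ) + 1 / 2) := by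
    intro t ht
    have htR : (1 : ℝ) ≤ t := by exact_mod_cast ht
    have hne1 : (t : ℝ) - 1 / 2 ≠ 0 := by linarith
    have hne2 : (t : ℝ) + 1 / 2 ≠ 0 := by linarith
    rw [div_sub_div _ _ hne1 hne2, inv_eq_one_div,
      div_le_div_iff₀ (by positivity) (by nlinarith)]
    nlinarith
  rcases le_or_gt X T with hXT | hXT
  · rw [Ico_eq_empty_of_le hXT, sum_empty]; positivity
  have htel : ∀ n : ℕ, ∑ t ∈ Ico T (T + n), (1 / ((t : ℝ) - 1 / 2) - 1 / ((t : ℝ) + 1 / 2)) =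
      1 / ((T : ℝ) - 1 / 2) - 1 / (((T + n : ℕ) : ℝ) - 1 / 2) := by
    intro n
    induction n with
    | zero => simp
    | succ n ih =>
      rw [← Nat.add_assoc, Finset.sum_Ico_succ_top (by omega), ih]
      push_cast; ring
  calc ∑ t ∈ Ico T X, ((t : ℝ) ^ 2)⁻¹
      ≤ ∑ t ∈ Ico T X, (1 / ((t : ℝ) - 1 / 2) - 1 / ((t : ℝ) + 1 / 2)) :=
        sum_le_sum fun t ht => hstep t (hT.trans (mem_Ico.1 ht).1)
    _ = 1 / ((T : ℝ) - 1 / 2) - 1 / ((X : ℝ) - 1 / 2) := by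
        have := htel (X - T)
        rwa [Nat.add_sub_cancel' hXT.le] at this
    _ ≤ 1 / ((T : ℝ) - 1 / 2) := by
        have hX : (T : ℝ) + 1 ≤ X := by exact_mod_cast hXT
        have : 0 < 1 / ((X : ℝ) - 1 / 2) := by apply div_pos one_pos; linarith
        linarith
    _ ≤ 2 / T := by
        rw [div_le_div_iff₀ (by linarith) (by positivity)]
        linarith

/-- **Tail estimate**: `∑_{a<K, T ≤ min(a, K−a)} Φ(a) ≤ K/(HT)` for `T ≥ 1`, `1 ≤ H`, `1 ≤ K`.
[folklore] -/
theorem sum_fejerPhi_tail_le {K H T : ℕ} (hH : 0 < H) (hK : 0 < K) (hT : 1 ≤ T) :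
    ∑ a ∈ (range K).filter (fun a => T ≤ min a (K - a)), fejerPhi K H a ≤ (K : ℝ) / (H * T) := by
  have hHR : (0 : ℝ) < H := by exact_mod_cast hH
  have hKR : (0 : ℝ) < K := by exact_mod_cast hK
  have hTR : (1 : ℝ) ≤ T := by exact_mod_cast hT
  -- pointwise: `Φ(a) ≤ K/(4H) · 1/min(a,K−a)²`
  have hpt : ∀ a ∈ (range K).filter (fun a => T ≤ min a (K - a)),
      fejerPhi K H a ≤ (K : ℝ) / (4 * H) * (((min a (K - a) : ℕ) : ℝ) ^ 2)⁻¹ := by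
    intro a ha
    rw [mem_filter, mem_range] at ha
    have hm1 : (1 : ℝ) ≤ ((min a (K - a) : ℕ) : ℝ) := by exact_mod_cast hT.trans ha.2
    have hdist : ((min a (K - a) : ℕ) : ℝ) / K ≤ distInt ((a : ℝ) / K) := by
      have := min_div_le_distInt hK ha.1.le
      push_cast [Nat.cast_sub ha.1.le]
      exact this
    have hd0 : 0 < ((min a (K - a) : ℕ) : ℝ) / K := by positivity
    have h1 := fejerPhi_mul_distInt_sq_le hH hK a
    have h3 : fejerPhi K H a * (((min a (K - a) : ℕ) : ℝ) / K) ^ 2 ≤ 1 / (4 * H * K) :=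
      le_trans (mul_le_mul_of_nonneg_left (pow_le_pow_left₀ hd0.le hdist 2)
        (fejerPhi_nonneg _ _ _)) h1
    rw [← le_div_iff₀ (by positivity)] at h3
    refine h3.trans (le_of_eq ?_)
    field_simp
  refine (sum_le_sum hpt).trans ?_
  rw [← mul_sum]
  -- the two halves `a ≤ K − a` and `a > K − a`
  set S := (range K).filter (fun a => T ≤ min a (K - a)) with hS
  have hlow : ∑ a ∈ S.filter (fun a => a ≤ K - a), (((min a (K - a) : ℕ) : ℝ) ^ 2)⁻¹ ≤ 2 / T := by
    calc ∑ a ∈ S.filter (fun a => a ≤ K - a), (((min a (K - a) : ℕ) : ℝ) ^ 2)⁻¹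
        = ∑ a ∈ S.filter (fun a => a ≤ K - a), ((a : ℝ) ^ 2)⁻¹ := by
          refine sum_congr rfl fun a ha => ?_
          rw [mem_filter] at ha
          rw [min_eq_left ha.2]
      _ ≤ ∑ t ∈ Ico T K, ((t : ℝ) ^ 2)⁻¹ := by
          refine sum_le_sum_of_subset_of_nonneg (fun a ha => ?_) (fun _ _ _ => by positivity)
          rw [mem_filter, hS, mem_filter, mem_range] at ha
          rw [mem_Ico]
          exact ⟨le_trans ha.1.2 (min_le_left _ _), ha.1.1⟩
      _ ≤ 2 / T := sum_Ico_inv_sq_le hT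
  have hhigh : ∑ a ∈ S.filter (fun a => ¬ a ≤ K - a), (((min a (K - a) : ℕ) : ℝ) ^ 2)⁻¹ ≤ 2 / T := by
    have hinj : Set.InjOn (fun a => K - a) ↑(S.filter (fun a => ¬ a ≤ K - a)) := by
      intro a ha b hb h
      rw [Finset.mem_coe, mem_filter, hS, mem_filter, mem_range] at ha hb
      have h' : K - a = K - b := h
      omega
    calc ∑ a ∈ S.filter (fun a => ¬ a ≤ K - a), (((min a (K - a) : ℕ) : ℝ) ^ 2)⁻¹
        = ∑ a ∈ S.filter (fun a => ¬ a ≤ K - a), ((((K - a : ℕ) : ℝ)) ^ 2)⁻¹ := by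
          refine sum_congr rfl fun a ha => ?_
          rw [mem_filter] at ha
          rw [min_eq_right (by omega)]
      _ = ∑ t ∈ (S.filter (fun a => ¬ a ≤ K - a)).image (fun a => K - a), ((t : ℝ) ^ 2)⁻¹ := by
          rw [sum_image hinj]
      _ ≤ ∑ t ∈ Ico T K, ((t : ℝ) ^ 2)⁻¹ := by
          refine sum_le_sum_of_subset_of_nonneg (fun t ht => ?_) (fun _ _ _ => by positivity)
          rw [mem_image] at ht
          obtain ⟨a, ha, rfl⟩ := ht
          rw [mem_filter, hS, mem_filter, mem_range] at ha
          rw [mem_Ico]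
          exact ⟨le_trans ha.1.2 (min_le_right _ _), by omega⟩
      _ ≤ 2 / T := sum_Ico_inv_sq_le hT
  have hsplit : ∑ a ∈ S, (((min a (K - a) : ℕ) : ℝ) ^ 2)⁻¹ ≤ 2 / T + 2 / T := by
    rw [← sum_filter_add_sum_filter_not S (fun a => a ≤ K - a)]
    exact add_le_add hlow hhigh
  calc (K : ℝ) / (4 * H) * ∑ a ∈ S, (((min a (K - a) : ℕ) : ℝ) ^ 2)⁻¹
      ≤ (K : ℝ) / (4 * H) * (2 / T + 2 / T) := mul_le_mul_of_nonneg_left hsplit (by positivity)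
    _ = (K : ℝ) / (H * T) := by field_simp; ring

end Literature.NumberTheory.LFunctions.MauduitRivat
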